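import Summits.CriticalPhenomena.PercolationContinuityZ3.Theorems.FK.Transplant.FHSlabPercolation
import Summits.CriticalPhenomena.PercolationContinuityZ3.Theorems.FK.Transplant.KNFreeSlabDefs
import HarnessLib

/-!
# FRONTIER TRANSPLANT, binder 2 (TP_FK) research line R-TP — T4-SLAB (G): the GATED COLLAR — the frozen set of the
# slab Step IV and its four properties (R-TP-NOTE-g184 §2; MEMO row `T4-SLAB [g122, R60]`)

Support file (`--supports stmt-CriticalPhenomena-4575`, helper) of the FRONTIER TRANSPLANT sub-cell (`fk-continuity/transplant/`,
seat `prim-bschramm-fkt-p1`); builds on p205010 (kernel theorem, internal audit signed; external expert review pending).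
0 definitions · 0 named facts · 0 sorries · standard axioms. File 12/18 of the bytes-first package (R60 (3)(β)) of the
UNFUNDED memo row `T4-SLAB [g122, R60]` (re-described R62 (E)); proposable only on a coordinator ruling.
Registered R63 (cell INBOX l.4709, 2026-08-23); registry row T4s; lead label T4s-12 (fkt-lead L22, l.4677).

HONEST FRAMING (page 1, cell rule). The transplant's theorem of record `ufsc0_of_freeBoundaryHypothesis_r3` (p248245) is
CONDITIONAL on FH AND on TP_FK = `KNFreeTargetHittable d q p`, both OPEN at the same `p` for `q > 1` near `p_c(q)` (⇔ GRC Conj.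
(5.103) via K1; barrier note `Literature.Barriers.CriticalPhenomena.SamePFreeBoundaryCriteria`, FBN-01, cited first); the
transplant is a typed reduction, not a proof of FK continuity. THIS FILE is pure lattice combinatorics: the frozen set `S` of the
slab Step IV is the collar of width `T` of the level box `Icc Lo Hi` (layers `1 … T`) MINUS the GATES — column vertices at depth
`2 … T` below a face `(f, τ)`, transversally deep, whose transverse coordinates lie on a sparse residue pattern (one coordinate
`≡ g₀ mod Pg`, all others `≡ g₀ mod Pbig`). Properties: `S ⊆ Icc (Lo+1) (Hi-1)`; `S` misses the interior; layer-1 points are in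
`S` (so Kozma–Nitzan's faces `U(x)` are); a transversally deep plate behind a face whose transverse coordinates avoid the residue
`g₀ mod Pbig` lies in `S` (the relay's sub-plates); and below every requested transverse window of length `Pbig` inside every lane
slab there is a gate column (the lanes' collar crossings). It proves nothing about either binder.

References: G. Kozma, S. Nitzan, arXiv:2401.12397 (2024), §4 Lemma 10 Step IV (pp. 19–21) [KozmaNitzan2024];
G. Grimmett, *The Random-Cluster Model*, Springer 2006, §5.7 (slabs inside boxes) [Grimmett2006].
-/

noncomputable section

namespace Summit.CriticalPhenomena.PercolationContinuityZ3.Theorems.FK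

open scoped Classical
open Literature.Probability.Percolation Literature.Probability.LatticeModels SimpleGraph
open Literature.Probability.Percolation.KozmaNitzan

variable {d : ℕ}

/-- The gated collar lies in the level box minus its boundary layer. [folklore] -/
theorem gatedCollar_subset (Lo Hi : Site d) (T Pg Pbig : ℕ) (g₀ : ℤ) :
    ((Finset.Icc (Lo + 1) (Hi - 1) \ Finset.Icc (Lo + ((T : Site d) + 1)) (Hi - ((T : Site d) + 1))).filter
      fun x => ¬ slabGate Lo Hi T Pg Pbig g₀ x) ⊆ Finset.Icc (Lo + 1) (Hi - 1) :=
  fun _ hx => (Finset.mem_sdiff.1 (Finset.mem_filter.1 hx).1).1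

/-- The gated collar misses the interior `Icc (Lo+T+1) (Hi-T-1)`. [folklore] -/
theorem gatedCollar_not_mem_interior (Lo Hi : Site d) (T Pg Pbig : ℕ) (g₀ : ℤ) :
    ∀ x ∈ ((Finset.Icc (Lo + 1) (Hi - 1) \ Finset.Icc (Lo + ((T : Site d) + 1)) (Hi - ((T : Site d) + 1))).filter
      fun x => ¬ slabGate Lo Hi T Pg Pbig g₀ x),
      x ∉ Finset.Icc (Lo + ((T : Site d) + 1)) (Hi - ((T : Site d) + 1)) :=
  fun _ hx => (Finset.mem_sdiff.1 (Finset.mem_filter.1 hx).1).2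

/-- **Layer-1 points are never gates**: a point of `Icc (Lo+1) (Hi-1)` at depth exactly `1` below some face (of a box
at least `2T + 3` wide there, `T ≥ 1`) lies in the gated collar. Hence Kozma–Nitzan's faces `U(x)` lie in `S`. [folklore] -/
theorem mem_gatedCollar_of_depth_one (Lo Hi : Site d) (T Pg Pbig : ℕ) (g₀ : ℤ) (hT : 1 ≤ T) {x : Site d}
    (hx : x ∈ Finset.Icc (Lo + 1) (Hi - 1)) {i : Fin d} (hwide : Lo i + 2 * (T : ℤ) + 2 ≤ Hi i)
    (hxi : x i = Hi i - 1 ∨ x i = Lo i + 1) :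
    x ∈ ((Finset.Icc (Lo + 1) (Hi - 1) \ Finset.Icc (Lo + ((T : Site d) + 1)) (Hi - ((T : Site d) + 1))).filter
      fun x => ¬ slabGate Lo Hi T Pg Pbig g₀ x) := by
  have hT' : (1 : ℤ) ≤ T := by exact_mod_cast hT
  refine Finset.mem_filter.2 ⟨Finset.mem_sdiff.2 ⟨hx, fun h => ?_⟩, ?_⟩
  · have := (mem_Icc_iff.1 h) i
    simp only [Pi.add_apply, Pi.sub_apply, Pi.natCast_apply, Pi.one_apply] at this
    rcases hxi with h1 | h1 <;> rw [h1] at this <;> omega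
  · rintro ⟨f, hdepth, hdeep, -⟩
    by_cases hfi : f = i
    · subst hfi; rcases hxi with h1 | h1 <;> rw [h1] at hdepth <;> omega
    · have := hdeep i (Ne.symm hfi)
      rcases hxi with h1 | h1 <;> rw [h1] at this <;> omega

/-- **A deep plate behind a face avoiding the residue `g₀ mod Pbig` lies in the gated collar** (`d ≥ 3`): every point at
depth `1 … T` below the face `(i, ±)`, at depth `> T` in the other directions, none of whose transverse coordinates is
`≡ g₀ (mod Pbig)`, is in `S` (a gate in direction `i` would need some transverse coordinate `≡ g₀ (mod Pbig)`; a gate in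
another direction would need depth `> T` in direction `i`). The relay's sub-plates. [folklore] -/
theorem mem_gatedCollar_of_plate (hd : 3 ≤ d) (Lo Hi : Site d) (T Pg Pbig : ℕ) (g₀ : ℤ) {x : Site d} (i : Fin d)
    (hwide : Lo i + (T : ℤ) + 2 ≤ Hi i) (hxi : (1 ≤ Hi i - x i ∧ Hi i - x i ≤ T) ∨ (1 ≤ x i - Lo i ∧ x i - Lo i ≤ T))
    (hdeep : ∀ b, b ≠ i → Lo b + T + 1 ≤ x b ∧ x b ≤ Hi b - T - 1)
    (hres : ∀ b, b ≠ i → ¬ x b ≡ g₀ [ZMOD Pbig]) :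
    x ∈ ((Finset.Icc (Lo + 1) (Hi - 1) \ Finset.Icc (Lo + ((T : Site d) + 1)) (Hi - ((T : Site d) + 1))).filter
      fun x => ¬ slabGate Lo Hi T Pg Pbig g₀ x) := by
  have hT0 : (0 : ℤ) ≤ T := Nat.cast_nonneg T
  refine Finset.mem_filter.2 ⟨Finset.mem_sdiff.2 ⟨mem_Icc_iff.2 fun b => ?_, fun h => ?_⟩, ?_⟩
  · simp only [Pi.add_apply, Pi.sub_apply, Pi.one_apply]
    by_cases hb : b = i
    · rw [hb]; rcases hxi with h | h <;> constructor <;> omega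
    · have := hdeep b hb; constructor <;> linarith
  · have := (mem_Icc_iff.1 h) i
    simp only [Pi.add_apply, Pi.sub_apply, Pi.natCast_apply, Pi.one_apply] at this
    rcases hxi with h1 | h1 <;> omega
  · rintro ⟨f, hdepth, hdeep', c', hc'f, -, hres'⟩
    by_cases hfi : f = i
    · subst hfi
      -- a third direction `b ∉ {f, c'}` carries the residue
      obtain ⟨b, hbf, hbc⟩ : ∃ b : Fin d, b ≠ f ∧ b ≠ c' := by
        by_contra hne
        rw [not_exists] at hne
        have hsub : (Finset.univ : Finset (Fin d)) ⊆ {f, c'} := by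
          intro y _
          rw [Finset.mem_insert, Finset.mem_singleton]
          by_cases hy : y = f
          · exact Or.inl hy
          · right; by_contra hyc; exact hne y ⟨hy, hyc⟩
        have := Finset.card_le_card hsub
        rw [Finset.card_univ, Fintype.card_fin] at this
        have h2 : ({f, c'} : Finset (Fin d)).card ≤ 2 := Finset.card_le_two
        omega
      exact hres b hbf (hres' b hbf hbc)
    · have := hdeep' i (Ne.symm hfi)
      rcases hxi with h1 | h1 <;> omega

/-- A representative of the residue `g₀ (mod P)` in every integer interval of length `P`. [folklore] -/
theorem exists_modEq_mem (P : ℕ) (hP : 1 ≤ P) (a₀ g₀ : ℤ) :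
    ∃ x : ℤ, a₀ ≤ x ∧ x ≤ a₀ + P - 1 ∧ x ≡ g₀ [ZMOD P] := by
  have hP0 : (0 : ℤ) < P := by exact_mod_cast hP
  refine ⟨a₀ + (g₀ - a₀) % P, by linarith [Int.emod_nonneg (g₀ - a₀) hP0.ne'],
    by linarith [Int.emod_lt_of_pos (g₀ - a₀) hP0], ?_⟩
  rw [Int.modEq_iff_dvd]
  have h := Int.emod_add_mul_ediv (g₀ - a₀) (P : ℤ)
  exact ⟨(g₀ - a₀) / P, by linarith⟩

/-- **Gate availability.** Below every requested transverse position — windows `[r_b, r_b + G]` (`G + 1 ≥ Pbig`) deep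
inside the box for `b ∉ {f, c}`, and the lane slab `[ζ - L, ζ + L]` (`2L + 1 ≥ Pg`) deep in direction `c ≠ f` — the
face `(f, τf)` has a gate column: a foot `wf` at depth `T + 1` whose column vertices at depths `2 … T` are NOT in the
gated collar. [cite: KozmaNitzan2024, §4 pp. 19–21 (Step IV)] -/
theorem exists_gate_foot (Lo Hi : Site d) (T Pg Pbig G L : ℕ) (g₀ : ℤ) (hPg : 1 ≤ Pg) (hPgL : Pg ≤ 2 * L + 1)
    (hPbig : 1 ≤ Pbig) (hPG : Pbig ≤ G + 1)
    (f c : Fin d) (hfc : f ≠ c) (τf yf : ℤ) (hfaceF : (τf = 1 ∧ yf = Hi f) ∨ (τf = -1 ∧ yf = Lo f))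
    (ζ : ℤ) (hslabIn : Lo c + T + 1 ≤ ζ - L ∧ ζ + L ≤ Hi c - T - 1)
    (r : Site d) (hr : ∀ b, b ≠ f → b ≠ c → Lo b + T + 1 ≤ r b ∧ r b + G ≤ Hi b - T - 1) :
    ∃ wf : Site d, wf f = yf - τf * ((T : ℤ) + 1) ∧ |wf c - ζ| ≤ (L : ℤ) ∧
      (∀ b, b ≠ f → b ≠ c → r b ≤ wf b ∧ wf b ≤ r b + G) ∧
      (∀ j : ℕ, 1 ≤ j → j + 1 ≤ T → Function.update wf f (yf - τf * ((T : ℤ) + 1) + τf * j) ∉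
        ((Finset.Icc (Lo + 1) (Hi - 1) \ Finset.Icc (Lo + ((T : Site d) + 1)) (Hi - ((T : Site d) + 1))).filter
          fun x => ¬ slabGate Lo Hi T Pg Pbig g₀ x)) := by
  -- the transverse coordinates: residue representatives in the requested windows
  obtain ⟨wc, hwc1, hwc2, hwcm⟩ := exists_modEq_mem Pg hPg (ζ - L) g₀
  have hwb : ∀ b : Fin d, ∃ w : ℤ, r b ≤ w ∧ w ≤ r b + G ∧ w ≡ g₀ [ZMOD Pbig] := by
    intro b
    obtain ⟨w, hw1, hw2, hwm⟩ := exists_modEq_mem Pbig hPbig (r b) g₀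
    have : (Pbig : ℤ) ≤ G + 1 := by exact_mod_cast hPG
    exact ⟨w, hw1, by linarith, hwm⟩
  choose w hw1 hw2 hwm using hwb
  have hPgL' : (Pg : ℤ) ≤ 2 * L + 1 := by exact_mod_cast hPgL
  set wf : Site d := fun b => if b = f then yf - τf * ((T : ℤ) + 1) else if b = c then wc else w b with hwf
  refine ⟨wf, by simp [hwf], ?_, fun b hbf hbc => ?_, fun j hj1 hjT hmem => ?_⟩
  · simp only [hwf, if_neg hfc.symm, if_true]; rw [abs_le]; constructor <;> linarith
  · simp only [hwf, if_neg hbf, if_neg hbc]; exact ⟨hw1 b, hw2 b⟩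
  · -- the column vertex at depth `T + 1 - j ∈ [2, T]` is a gate
    have hng := (Finset.mem_filter.1 hmem).2
    apply hng
    have hjT' : (j : ℤ) + 1 ≤ T := by exact_mod_cast hjT
    have hj1' : (1 : ℤ) ≤ j := by exact_mod_cast hj1
    refine ⟨f, ?_, fun b hbf => ?_, c, hfc.symm, ?_, fun b hbf hbc => ?_⟩
    · rw [Function.update_self]
      rcases hfaceF with ⟨hτ, hy⟩ | ⟨hτ, hy⟩
      · left; rw [hτ, hy]; constructor <;> linarith
      · right; rw [hτ, hy]; constructor <;> linarith
    · rw [Function.update_of_ne hbf]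
      simp only [hwf, if_neg hbf]
      by_cases hbc : b = c
      · rw [if_pos hbc, hbc]; constructor <;> linarith
      · rw [if_neg hbc]; have := hr b hbf hbc; constructor <;> linarith [hw1 b, hw2 b]
    · rw [Function.update_of_ne hfc.symm]; simp only [hwf, if_neg hfc.symm, if_true]; exact hwcm
    · rw [Function.update_of_ne hbf]; simp only [hwf, if_neg hbf, if_neg hbc]; exact hwm b

end Summit.CriticalPhenomena.PercolationContinuityZ3.Theorems.FK

end
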